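import Summits.BirchSwinnertonDyer.BirchSwinnertonDyer.Theorems.Rank2ShaRowKit
import Summits.BirchSwinnertonDyer.BirchSwinnertonDyer.Theorems.Rank2ShaAtlasRow
import Summits.BirchSwinnertonDyer.BirchSwinnertonDyer.Theorems.Rank2ObservatoryPadicAtlasR2A00
import Summits.BirchSwinnertonDyer.BirchSwinnertonDyer.Theorems.Rank2ObservatoryKernelCerts001
import HarnessLib

/-!
# BirchSwinnertonDyer — rank-2 `Ш[p^∞]` cell: ROW 0 — Stein–Wuthrich's running example `446d1` at `p = 5`

HONEST FRAMING (cell `b2b-bsdr2sha`, run/shared/lean/b2b/bsd-rank2-sha/): per-pair certified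
theorems «cited hypotheses ∧ certified computation ⇒ `Ш(E/ℚ)[p^∞]` finite of order `p^k`» for
rank-2 curves at good ordinary primes; NO claim on BSD in rank `≥ 2`, no class-level theorem, every
published input is a NAMED HYPOTHESIS of the tree (nothing is asserted or minted here).

Row 0 of the cell's census (PLAN.md §6: "frame file elaborating on the STEP-0 curve `446d1@5` as row 0,
in both frames") — the running example `E₀ = 446d1 = [1, −1, 0, −4, 4]` of W. Stein, C. Wuthrich,
*Algorithms for the arithmetic of elliptic curves using Iwasawa theory*, Math. Comp. 82 (2013): rank 2,
`N = 446 = 2·223`, `p = 5` good ordinary and ANOMALOUS (`a_5 = −4`, `#Ẽ(𝔽_5) = 10`), `L_5(E₀,T) = O(5⁴)·T +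
(5 + 5² + 3·5³ + O(5⁴))·T² + …` (§3 (3.3), p. 1766: `ord_5 [T²] L_5 = 1`), `Reg_5(E₀/ℚ) = 2·5 + 2·5² + 5⁴ +
O(5⁵)` (eq. (4.2), p. 1771: `ord_5 Reg_5 = 1`), `#Ш(E₀/ℚ)(5) = 1 + O(5³)` (p. 1775, §6.1/§7.1: `Ш(E₀/ℚ)(5)` is
trivial). KERNEL DATA of the row (all `decide +kernel`): the observatory atlas curve `c446d1`
(`Rank2ObservatoryPadicAtlasR2A00`: model, minimality, the level-`5³` symbol certificate with `A = 16`,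
`H = 410`, `L = 0`, hence `a = ord_5(A·H − L) = ord_5 6560 = 1`, and `#Ẽ(𝔽_5) = 10`); the rank certificate
`KernelCerts001.C446d1.two_le_rank`; NEW here: the Skinner–Urban witness `w446d1 = (ℓ = 2, e = v_2(Δ) = 2,
5 ∤ 2; ℓ' = 3, #Ẽ(𝔽_3) = 7, X² + 3X + 3` irreducible mod `5`)` — so (ram) at `2 ‖ 446` and `E₀[5]`
irreducible — and the Tamagawa row certificate `tam446d1` (`2`: type `I₂` non-split, `c_2 = 2`; `223`:
`I₁` split, `c_223 = 1`; `Δ_min = 892 = 2²·223`), so `ord_5 ∏c_ℓ = 0`. REMAINING HYPOTHESES of the row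
theorems (exactly the census's named facts and engine data): `hS` (Perrin-Riou–Schneider, BMS 2016
Thm. 1.7), `hSU` (Skinner–Urban 2014 Thm. 3.6.9) resp. `hK` (Kato 2004 Thm. 17.4) and `hsurj` (Serre
witnesses, census H5), the newform `hf`, the symbol DATA `hint`/`htab` (the tabulated numerators ARE
`D·[u/125]⁺`, `D·[u/25]⁺`), THE canonical `5`-adic height `Dh` and its certified regulator valuation
`b = ord_5 Reg_5(E₀) = 1` (H8; SW13 (4.2), two engines of the cell).

RESULTS: `sha_446d1_5_su` — frame «su-exact»: `rank = 2`, `Ш(E₀/ℚ)[5^∞]` finite, `Reg_5 ≠ 0`,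
`#Ш(E₀/ℚ)[5^∞] = 5^k` with `k = 1 − b`; at the certified `b = 1`: `#Ш(E₀/ℚ)[5^∞] = 1` (`…_eq_one`).
`sha_446d1_5_kato` — frame «kato-bound»: `ord_5 #Ш(E₀/ℚ)[5^∞] ≤ 1 − b`, `= 1` at `b = 1`. Per pair; NOT a
class theorem; inside SW13's range (a certified re-proof of a published statement, PLAN §1(a)).

References: W. Stein, C. Wuthrich, Math. Comp. 82 (2013), §3 (3.3), §4 (4.2), §6.1, §7.1
[SteinWuthrich2013]; C. Skinner, E. Urban, Invent. Math. 195 (2014), Thm. 3.6.9 [SkinnerUrban2014];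
K. Kato, Astérisque 295 (2004), Thm. 17.4 [Kato2004Asterisque]; J. Balakrishnan, J. S. Müller, W. Stein,
Math. Comp. 85 (2016), Thm. 1.7 [BalakrishnanMullerStein2015]; J. E. Cremona, *Algorithms for Modular
Elliptic Curves* (1997), Table 1 (label `446d1`) [CremonaAlgorithms1997].
-/

set_option autoImplicit false

-- single-conjunct summit: `Summit.BirchSwinnertonDyer.BirchSwinnertonDyer.…` repeats the name by design
set_option linter.dupNamespace false

noncomputable section

open scoped Classical MatrixGroups ModularForm

open CongruenceSubgroup WeierstrassCurve Literature.NumberTheory.EllipticCurves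
  Literature.NumberTheory.EllipticCurves.ModularForms
  Literature.NumberTheory.EllipticCurves.Rank1Residual
  Summit.BirchSwinnertonDyer.BirchSwinnertonDyer.Rank2Observatory

namespace Summit.BirchSwinnertonDyer.BirchSwinnertonDyer.Rank2Sha

namespace Row446d1

/-! ## §1. Kernel data of the row -/

/-- The `p = 5` cell of the atlas curve `c446d1` (VERBATIM copy of the first cell of
`Rank2ObservatoryPadicAtlasR2A00.c446d1`, membership re-checked in the kernel by `cell_mem`): level
`n = 2` (measure level `5³`), `A = 16 ≡ α (mod 25)`, `H = 410`, `L = 0`.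
[cite: MazurTateTeitelbaum1986Invent, §I.10–I.13] [cite: SteinWuthrich2013, §3 (3.3)] -/
def cell5 : AtlasCell :=
  ⟨5, -4, 2, 16, [0,-1,-1,0,2,0,0,1,-1,0,0,2,-2,0,1,0,2,-1,0,2,0,1,-1,-1,2,0,1,0,-1,2,0,0,-1,-1,2,0,2,-1,-2,0,0,1,1,-1,-1,0,0,-1,-3,0,0,0,-1,-3,1,0,1,-1,0,1,0,1,-1,-1,1,0,1,0,-1,1,0,1,-3,-1,0,0,0,-3,-1,0,0,-1,-1,1,1,0,0,-2,-1,2,0,2,-1,-1,0,0,2,-1,0,1,0,2,-1,-1,1,0,2,0,-1,2,0,1,0,-2,2,0,0,-1,1,0,0,2,0,-1,-1], [0,-1,2,2,-2,0,-1,1,1,-2,0,-2,2,2,-2,0,-2,1,1,-1,0,-2,2,2,-1], 410, 0⟩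

/-- The copied cell IS a cell of the atlas curve `c446d1` (kernel). [folklore] -/
theorem cell_mem : cell5 ∈ c446d1.cells := List.mem_cons_self

/-- The two kernel tests of `446d1` (from the atlas certificate `c446d1_ok`). [folklore] -/
theorem check : c446d1.check = true ∧ c446d1.minCheck = true := by
  simpa only [Bool.and_eq_true] using c446d1_ok

/-- `446d1 ⊗ ℚ` is elliptic (kernel: `Δ ≠ 0`). [folklore] -/
instance isElliptic : (c446d1.e.baseChange ℚ).IsElliptic := AtlasCurve.isElliptic check.1

/-- The integer model `[1, −1, 0, −4, 4]` of `446d1` is globally minimal (kernel: the finite criterion).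
[cite: SilvermanAEC2009, VII.1 Remark 1.1] -/
instance isGloballyMinimal : (c446d1.e.baseChange ℚ).IsGloballyMinimal :=
  AtlasCurve.isGloballyMinimal check.2

/-- `5` is prime, as the `Fact` on the cell's prime. [folklore] -/
instance factPrime : Fact cell5.p.Prime := ⟨by decide⟩

/-- **The Skinner–Urban witness of `(446d1, 5)`**: (ram) at `ℓ = 2` (`2² ∥ Δ_min = 892`, `2 ∤ c₄ = 201`,
`5 ∤ 2`) and the Frobenius witness `ℓ' = 3` (`#Ẽ(𝔽_3) = 7`, `a_3 = −3`, `X² + 3X + 3` has no root mod `5`)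
for the irreducibility of `E₀[5]`. [cite: SkinnerUrban2014, Thm. 3.6.9 (p. 45)] [cite: Mazur1978, §6 Prop. 6.3 (1)] -/
def w446d1 : SuWitness := ⟨2, 1, 2, 3, 1, 7⟩

/-- The witness passes its kernel test at `p = 5`. [folklore] -/
theorem w446d1_check : w446d1.check c446d1.e cell5.p = true := by decide +kernel

/-- **The Tamagawa row certificate of `446d1`**: `2` of type `I₂`, non-split (no root of the node-tangent
quadratic mod `2`), `c_2 = 2`; `223` of type `I₁`, split (root `53`), `c_223 = 1`; `|Δ| = 2²·223`.
[cite: SilvermanATAEC1994, IV.9.4 Step 2] [cite: CremonaAlgorithms1997, Table 1 (label `446d1`)] -/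
def tam446d1 : List Tam.TamLocal :=
  [⟨2, 1, 2, 0, 0, 0, 0, 2, 0, 0, 2⟩, ⟨223, 14, 1, 53, 0, 0, 0, 1, 0, 0, 1⟩]

/-- The Tamagawa row certificate checks and is exact; `∏c_ℓ = 2`. [folklore] -/
theorem tam446d1_check : Tam.TamLocal.rowCheck tam446d1 c446d1.e = true ∧
    Tam.TamLocal.rowExact tam446d1 = true ∧ Tam.TamLocal.rowValue tam446d1 = 2 := by
  refine ⟨by decide +kernel, by decide +kernel, by decide +kernel⟩

/-- **The kernel integers of the row**: `a = ord_5(A·H − L) = ord_5 6560 = 1` (= `ord_5 [T²]L_5`, SW13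
(3.3)), `ord_5 #Ẽ(𝔽_5) = ord_5 10 = 1` (anomalous), `ord_5 ∏c_ℓ = ord_5 2 = 0`. [cite: SteinWuthrich2013, §3 (3.3)] -/
theorem ints : padicValInt cell5.p (cell5.A * cell5.H - cell5.L) = 1 ∧
    padicValNat cell5.p (cell5.count c446d1.e) = 1 ∧
    padicValNat cell5.p (Tam.TamLocal.rowValue tam446d1) = 0 := by
  refine ⟨by decide +kernel, by decide +kernel, by decide +kernel⟩

/-- The census rank certificate of the row: `2 ≤ rank_ℤ E₀(ℚ)` (tree, `KernelCerts001.C446d1.two_le_rank`: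
two listed generators independent modulo torsion, in the kernel). [cite: CremonaAlgorithms1997, Table 1 (label `446d1`)] -/
theorem two_le_rank : 2 ≤ c446d1.row.curve.mordellWeilRank :=
  KernelCerts001.C446d1.two_le_rank

/-! ## §2. The row theorems -/

/-- **ROW 0, frame «su-exact»: `#Ш(446d1/ℚ)[5^∞] = 5^{1 − b}`.** Named facts `hS` (BMS Thm. 1.7), `hSU`
(S–U Thm. 3.6.9); the newform `hf`; the symbol DATA `hint`/`htab` of the level-`5³` table; THE canonical
`5`-adic height `Dh` with `ord_5 Reg_5(E₀, Dh) = b`. Everything else — good ordinary, `E₀[5]` irreducible,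
(ram) at `2`, `[T²]L_5 ≠ 0` with `ord_5 = 1`, `#Ẽ(𝔽_5) = 10`, `∏c_ℓ = 2`, `2 ≤ rank`, minimality — is
discharged in the kernel. CONCLUSION: `rank = 2`, `Ш(E₀/ℚ)[5^∞]` finite, `Reg_5 ≠ 0`,
`#Ш(E₀/ℚ)[5^∞] = 5^k`, `k = 1 − b`. [cite: SteinWuthrich2013, §3 (3.3), §4 (4.2), §6.1]
[cite: SkinnerUrban2014, Thm. 3.6.9 (p. 45)] [cite: BalakrishnanMullerStein2015, Thm. 1.7] -/
theorem sha_446d1_5_su (hS : Schneider1985_order_charGenerator_odd)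
    {N : ℕ} [NeZero N] {f : CuspForm (Gamma0 N) 2} (hf : IsNewformOf (c446d1.e.baseChange ℚ) f)
    (hSU : ∀ (κ : ZpExtension ℚ cell5.p) (γ : Field.absoluteGaloisGroup ℚ),
      skinner_urban_main_conjecture (c446d1.e.baseChange ℚ) cell5.p (κ := κ) (γ := γ) (f := f))
    (D : ℚ) (hD : ‖(D : ℚ_[cell5.p])‖ = 1)
    (hint : ∀ x : ℚ, ‖(ratPlusSymbol f x : ℚ_[cell5.p])‖ ≤ 1)
    (htab : ∀ u : ℕ, u < cell5.p ^ (cell5.n + 1) → ¬ cell5.p ∣ u →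
      ratPlusSymbol f ((u : ℚ) / (cell5.p : ℚ) ^ (cell5.n + 1)) = (cell5.tabHi.getD u 0 : ℚ) / D ∧
      ratPlusSymbol f ((u : ℚ) / (cell5.p : ℚ) ^ cell5.n) =
        (cell5.tabLo.getD (u % cell5.p ^ cell5.n) 0 : ℚ) / D)
    (Dh : PAdicHeightData (c446d1.e.baseChange ℚ) cell5.p) (hDh : Dh.IsCanonical) {b : ℤ}
    (hreg : (padicRegulator Dh).valuation = b) :
    c446d1.row.curve.mordellWeilRank = 2 ∧
      Finite (AddCommGroup.primaryComponent (c446d1.e.baseChange ℚ).sha cell5.p) ∧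
      SchneiderConjecture Dh ∧
      ∃ k : ℕ, Nat.card (AddCommGroup.primaryComponent (c446d1.e.baseChange ℚ).sha cell5.p) = 5 ^ k ∧
        (k : ℤ) = 1 - b := by
  obtain ⟨hr, hfin, hSch, k, hk, hkval⟩ := AtlasCurve.shaRowSU check.1 cell_mem w446d1_check
    tam446d1_check.1 tam446d1_check.2.1 hS hf hSU two_le_rank D hD hint htab Dh hDh hreg
  obtain ⟨h1, h2, h3⟩ := ints
  refine ⟨hr, hfin, hSch, k, hk, ?_⟩
  rw [hkval, h1, h2, h3]
  ring

/-- **ROW 0 at the certified regulator valuation `b = 1` (SW13 (4.2): `Reg_5(E₀) = 2·5 + O(5²)`):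
`Ш(446d1/ℚ)[5^∞] = 0`** — Stein–Wuthrich's "`#Ш(E₀/ℚ) = 1 + O(5³)` … `Ш(E₀/ℚ)(5)` is trivial" as a kernel
theorem of the su-exact frame. [cite: SteinWuthrich2013, §4 (4.2) and p. 1775]
[cite: SkinnerUrban2014, Thm. 3.6.9 (p. 45)] [cite: BalakrishnanMullerStein2015, Thm. 1.7] -/
theorem sha_446d1_5_su_eq_one (hS : Schneider1985_order_charGenerator_odd)
    {N : ℕ} [NeZero N] {f : CuspForm (Gamma0 N) 2} (hf : IsNewformOf (c446d1.e.baseChange ℚ) f)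
    (hSU : ∀ (κ : ZpExtension ℚ cell5.p) (γ : Field.absoluteGaloisGroup ℚ),
      skinner_urban_main_conjecture (c446d1.e.baseChange ℚ) cell5.p (κ := κ) (γ := γ) (f := f))
    (D : ℚ) (hD : ‖(D : ℚ_[cell5.p])‖ = 1)
    (hint : ∀ x : ℚ, ‖(ratPlusSymbol f x : ℚ_[cell5.p])‖ ≤ 1)
    (htab : ∀ u : ℕ, u < cell5.p ^ (cell5.n + 1) → ¬ cell5.p ∣ u →
      ratPlusSymbol f ((u : ℚ) / (cell5.p : ℚ) ^ (cell5.n + 1)) = (cell5.tabHi.getD u 0 : ℚ) / D ∧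
      ratPlusSymbol f ((u : ℚ) / (cell5.p : ℚ) ^ cell5.n) =
        (cell5.tabLo.getD (u % cell5.p ^ cell5.n) 0 : ℚ) / D)
    (Dh : PAdicHeightData (c446d1.e.baseChange ℚ) cell5.p) (hDh : Dh.IsCanonical)
    (hreg : (padicRegulator Dh).valuation = 1) :
    c446d1.row.curve.mordellWeilRank = 2 ∧ SchneiderConjecture Dh ∧
      Nat.card (AddCommGroup.primaryComponent (c446d1.e.baseChange ℚ).sha cell5.p) = 1 := by
  obtain ⟨hr, -, hSch, k, hk, hkval⟩ := sha_446d1_5_su hS hf hSU D hD hint htab Dh hDh hreg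
  have hk0 : k = 0 := by omega
  rw [hk0, pow_zero] at hk
  exact ⟨hr, hSch, hk⟩

/-- **ROW 0, frame «kato-bound»: `ord_5 #Ш(446d1/ℚ)[5^∞] ≤ 1 − b`** (Kato Thm. 17.4 `hK` + BMS Thm. 1.7
`hS`; the census surjectivity bit `hsurj : Surj E₀ 5` — Serre witnesses, H5 —; newform, symbol DATA,
THE canonical height with `ord_5 Reg_5 = b`). [cite: Kato2004Asterisque, Thm. 17.4 (3) (p. 273)]
[cite: BalakrishnanMullerStein2015, Thm. 1.7] [cite: SteinWuthrich2013, Alg. 11.1] -/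
theorem sha_446d1_5_kato (hS : Schneider1985_order_charGenerator_odd)
    {N : ℕ} [NeZero N] {f : CuspForm (Gamma0 N) 2} (hf : IsNewformOf (c446d1.e.baseChange ℚ) f)
    (hK : ∀ (κ : ZpExtension ℚ cell5.p) (γ : Field.absoluteGaloisGroup ℚ),
      kato_divisibility (c446d1.e.baseChange ℚ) cell5.p (κ := κ) (γ := γ) (f := f))
    (hsurj : (c446d1.e.baseChange ℚ).HasSurjectiveModNGaloisRep cell5.p)
    (D : ℚ) (hD : ‖(D : ℚ_[cell5.p])‖ = 1)
    (hint : ∀ x : ℚ, ‖(ratPlusSymbol f x : ℚ_[cell5.p])‖ ≤ 1)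
    (htab : ∀ u : ℕ, u < cell5.p ^ (cell5.n + 1) → ¬ cell5.p ∣ u →
      ratPlusSymbol f ((u : ℚ) / (cell5.p : ℚ) ^ (cell5.n + 1)) = (cell5.tabHi.getD u 0 : ℚ) / D ∧
      ratPlusSymbol f ((u : ℚ) / (cell5.p : ℚ) ^ cell5.n) =
        (cell5.tabLo.getD (u % cell5.p ^ cell5.n) 0 : ℚ) / D)
    (Dh : PAdicHeightData (c446d1.e.baseChange ℚ) cell5.p) (hDh : Dh.IsCanonical) {b : ℤ}
    (hreg : (padicRegulator Dh).valuation = b) :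
    c446d1.row.curve.mordellWeilRank = 2 ∧
      Finite (AddCommGroup.primaryComponent (c446d1.e.baseChange ℚ).sha cell5.p) ∧
      SchneiderConjecture Dh ∧
      (padicValNat cell5.p
        (Nat.card (AddCommGroup.primaryComponent (c446d1.e.baseChange ℚ).sha cell5.p)) : ℤ) ≤ 1 - b := by
  obtain ⟨hr, hfin, hSch, hle⟩ := AtlasCurve.shaRowKato check.1 cell_mem tam446d1_check.1
    tam446d1_check.2.1 hS hf hK hsurj two_le_rank D hD hint htab Dh hDh hreg
  obtain ⟨h1, h2, h3⟩ := ints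
  refine ⟨hr, hfin, hSch, ?_⟩
  rw [h1, h2, h3] at hle
  omega

/-- **ROW 0, frame «kato-bound», at `b = 1`: `Ш(446d1/ℚ)[5^∞] = 0`** (the Stein–Wuthrich verdict
«`Ш(E₀/ℚ)[5] = 0`», Kato alone). [cite: SteinWuthrich2013, §4 (4.2) and p. 1775]
[cite: Kato2004Asterisque, Thm. 17.4 (3) (p. 273)] [cite: BalakrishnanMullerStein2015, Thm. 1.7] -/
theorem sha_446d1_5_kato_eq_one (hS : Schneider1985_order_charGenerator_odd)
    {N : ℕ} [NeZero N] {f : CuspForm (Gamma0 N) 2} (hf : IsNewformOf (c446d1.e.baseChange ℚ) f)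
    (hK : ∀ (κ : ZpExtension ℚ cell5.p) (γ : Field.absoluteGaloisGroup ℚ),
      kato_divisibility (c446d1.e.baseChange ℚ) cell5.p (κ := κ) (γ := γ) (f := f))
    (hsurj : (c446d1.e.baseChange ℚ).HasSurjectiveModNGaloisRep cell5.p)
    (D : ℚ) (hD : ‖(D : ℚ_[cell5.p])‖ = 1)
    (hint : ∀ x : ℚ, ‖(ratPlusSymbol f x : ℚ_[cell5.p])‖ ≤ 1)
    (htab : ∀ u : ℕ, u < cell5.p ^ (cell5.n + 1) → ¬ cell5.p ∣ u →
      ratPlusSymbol f ((u : ℚ) / (cell5.p : ℚ) ^ (cell5.n + 1)) = (cell5.tabHi.getD u 0 : ℚ) / D ∧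
      ratPlusSymbol f ((u : ℚ) / (cell5.p : ℚ) ^ cell5.n) =
        (cell5.tabLo.getD (u % cell5.p ^ cell5.n) 0 : ℚ) / D)
    (Dh : PAdicHeightData (c446d1.e.baseChange ℚ) cell5.p) (hDh : Dh.IsCanonical)
    (hreg : (padicRegulator Dh).valuation = 1) :
    c446d1.row.curve.mordellWeilRank = 2 ∧ SchneiderConjecture Dh ∧
      Nat.card (AddCommGroup.primaryComponent (c446d1.e.baseChange ℚ).sha cell5.p) = 1 := by
  obtain ⟨hr, hfin, hSch, hone⟩ := AtlasCurve.shaRowKato_eq_one check.1 cell_mem tam446d1_check.1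
    tam446d1_check.2.1 hS hf hK hsurj two_le_rank D hD hint htab Dh hDh hreg (by
      obtain ⟨h1, h2, h3⟩ := ints
      rw [h1, h2, h3]; norm_num)
  exact ⟨hr, hSch, hone⟩

end Row446d1


/-! ## §3. ROW 0 with the integrality binder DISCHARGED and the image bit KERNEL-witnessed
(referee R-013 F1/F2; appended) -/

namespace Row446d1

/-- **The Serre witness of `(446d1, 5)`** (H5, Serre 1972 Prop. 19): `ℓ₁ = 13` (`#Ẽ(𝔽_13) = 20`,
`a_13 = −6`, `a² − 4ℓ ≡ 4 = 2² (mod 5)`, split, `a ≢ 0`), `ℓ₂ = 3` (`#Ẽ(𝔽_3) = 7`, `a_3 = −3`,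
`a² − 4ℓ ≡ 2` a non-square mod `5`), `ℓ₃ = 3` (`u = a²/ℓ = 9/3 ≡ 3 (mod 5)`, `u ∉ {0,1,2,4}`,
`u² − 3u + 1 ≡ 1`). [cite: Serre1972, §2.8 Prop. 19] -/
def s446d1 : SurjWitness := ⟨13, 3, 20, 2, 3, 1, 7, 3, 1, 7, 3⟩

/-- The Serre witness passes its kernel test at `p = 5`. [folklore] -/
theorem s446d1_check : s446d1.check c446d1.e cell5.p = true := by decide +kernel

/-- **ROW 0, frame «su-exact», NO integrality binder** (`hint` discharged by the tree theorem
`norm_ratPlusSymbol_le_one_of_irreducible`, `E₀[5]` irreducible from the kernel witness `w446d1`):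
named facts `hS`, `hSU`; newform `hf`; the symbol TABLE datum `htab` (`‖D‖_5 = 1`); THE canonical
`5`-adic height `Dh` with `ord_5 Reg_5(E₀, Dh) = b` ⇒ `rank = 2`, `Ш(E₀/ℚ)[5^∞]` finite, `Reg_5 ≠ 0`,
`#Ш(E₀/ℚ)[5^∞] = 5^k`, `k = 1 − b`. [cite: SteinWuthrich2013, §3 (3.3), Lemma 3.6, §4 (4.2), §6.1]
[cite: SkinnerUrban2014, Thm. 3.6.9 (p. 45)] [cite: BalakrishnanMullerStein2015, Thm. 1.7] -/
theorem sha_446d1_5 (hS : Schneider1985_order_charGenerator_odd)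
    {N : ℕ} [NeZero N] {f : CuspForm (Gamma0 N) 2} (hf : IsNewformOf (c446d1.e.baseChange ℚ) f)
    (hSU : ∀ (κ : ZpExtension ℚ cell5.p) (γ : Field.absoluteGaloisGroup ℚ),
      skinner_urban_main_conjecture (c446d1.e.baseChange ℚ) cell5.p (κ := κ) (γ := γ) (f := f))
    (D : ℚ) (hD : ‖(D : ℚ_[cell5.p])‖ = 1)
    (htab : ∀ u : ℕ, u < cell5.p ^ (cell5.n + 1) → ¬ cell5.p ∣ u →
      ratPlusSymbol f ((u : ℚ) / (cell5.p : ℚ) ^ (cell5.n + 1)) = (cell5.tabHi.getD u 0 : ℚ) / D ∧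
      ratPlusSymbol f ((u : ℚ) / (cell5.p : ℚ) ^ cell5.n) =
        (cell5.tabLo.getD (u % cell5.p ^ cell5.n) 0 : ℚ) / D)
    (Dh : PAdicHeightData (c446d1.e.baseChange ℚ) cell5.p) (hDh : Dh.IsCanonical) {b : ℤ}
    (hreg : (padicRegulator Dh).valuation = b) :
    c446d1.row.curve.mordellWeilRank = 2 ∧
      Finite (AddCommGroup.primaryComponent (c446d1.e.baseChange ℚ).sha cell5.p) ∧
      SchneiderConjecture Dh ∧
      ∃ k : ℕ, Nat.card (AddCommGroup.primaryComponent (c446d1.e.baseChange ℚ).sha cell5.p) = 5 ^ k ∧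
        (k : ℤ) = 1 - b := by
  obtain ⟨hr, hfin, hSch, k, hk, hkval⟩ := AtlasCurve.shaRowSU' check.1 cell_mem w446d1_check
    tam446d1_check.1 tam446d1_check.2.1 hS hf hSU two_le_rank D hD htab Dh hDh hreg
  obtain ⟨h1, h2, h3⟩ := ints
  refine ⟨hr, hfin, hSch, k, hk, ?_⟩
  rw [hkval, h1, h2, h3]
  ring

/-- **ROW 0 at `b = ord_5 Reg_5 = 1`, NO integrality binder: `Ш(446d1/ℚ)[5^∞] = 0`.**
[cite: SteinWuthrich2013, §4 (4.2) and p. 1775] [cite: SkinnerUrban2014, Thm. 3.6.9 (p. 45)] -/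
theorem sha_446d1_5_eq_one (hS : Schneider1985_order_charGenerator_odd)
    {N : ℕ} [NeZero N] {f : CuspForm (Gamma0 N) 2} (hf : IsNewformOf (c446d1.e.baseChange ℚ) f)
    (hSU : ∀ (κ : ZpExtension ℚ cell5.p) (γ : Field.absoluteGaloisGroup ℚ),
      skinner_urban_main_conjecture (c446d1.e.baseChange ℚ) cell5.p (κ := κ) (γ := γ) (f := f))
    (D : ℚ) (hD : ‖(D : ℚ_[cell5.p])‖ = 1)
    (htab : ∀ u : ℕ, u < cell5.p ^ (cell5.n + 1) → ¬ cell5.p ∣ u →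
      ratPlusSymbol f ((u : ℚ) / (cell5.p : ℚ) ^ (cell5.n + 1)) = (cell5.tabHi.getD u 0 : ℚ) / D ∧
      ratPlusSymbol f ((u : ℚ) / (cell5.p : ℚ) ^ cell5.n) =
        (cell5.tabLo.getD (u % cell5.p ^ cell5.n) 0 : ℚ) / D)
    (Dh : PAdicHeightData (c446d1.e.baseChange ℚ) cell5.p) (hDh : Dh.IsCanonical)
    (hreg : (padicRegulator Dh).valuation = 1) :
    c446d1.row.curve.mordellWeilRank = 2 ∧ SchneiderConjecture Dh ∧
      Nat.card (AddCommGroup.primaryComponent (c446d1.e.baseChange ℚ).sha cell5.p) = 1 := by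
  obtain ⟨hr, -, hSch, k, hk, hkval⟩ := sha_446d1_5 hS hf hSU D hD htab Dh hDh hreg
  have hk0 : k = 0 := by omega
  rw [hk0, pow_zero] at hk
  exact ⟨hr, hSch, hk⟩

/-- **ROW 0, frame «kato-bound», NO integrality binder and NO assumed surjectivity** (`ρ̄_{E₀,5}` onto
`GL₂(𝔽_5)` from the kernel Serre witness `s446d1`): named facts `hS`, `hK` (Kato Thm. 17.4); newform;
symbol table; THE canonical height with `ord_5 Reg_5 = b` ⇒ `rank = 2`, `Ш(E₀/ℚ)[5^∞]` finite,
`Reg_5 ≠ 0`, `ord_5 #Ш(E₀/ℚ)[5^∞] ≤ 1 − b`, and `#Ш = 1` if `1 − b ≤ 0`.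
[cite: Kato2004Asterisque, Thm. 17.4 (3) (p. 273)] [cite: Serre1972, §2.8 Prop. 19]
[cite: SteinWuthrich2013, Lemma 3.6 and Alg. 11.1] [cite: BalakrishnanMullerStein2015, Thm. 1.7] -/
theorem sha_446d1_5_katoK (hS : Schneider1985_order_charGenerator_odd)
    {N : ℕ} [NeZero N] {f : CuspForm (Gamma0 N) 2} (hf : IsNewformOf (c446d1.e.baseChange ℚ) f)
    (hK : ∀ (κ : ZpExtension ℚ cell5.p) (γ : Field.absoluteGaloisGroup ℚ),
      kato_divisibility (c446d1.e.baseChange ℚ) cell5.p (κ := κ) (γ := γ) (f := f))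
    (D : ℚ) (hD : ‖(D : ℚ_[cell5.p])‖ = 1)
    (htab : ∀ u : ℕ, u < cell5.p ^ (cell5.n + 1) → ¬ cell5.p ∣ u →
      ratPlusSymbol f ((u : ℚ) / (cell5.p : ℚ) ^ (cell5.n + 1)) = (cell5.tabHi.getD u 0 : ℚ) / D ∧
      ratPlusSymbol f ((u : ℚ) / (cell5.p : ℚ) ^ cell5.n) =
        (cell5.tabLo.getD (u % cell5.p ^ cell5.n) 0 : ℚ) / D)
    (Dh : PAdicHeightData (c446d1.e.baseChange ℚ) cell5.p) (hDh : Dh.IsCanonical) {b : ℤ}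
    (hreg : (padicRegulator Dh).valuation = b) :
    c446d1.row.curve.mordellWeilRank = 2 ∧
      Finite (AddCommGroup.primaryComponent (c446d1.e.baseChange ℚ).sha cell5.p) ∧
      SchneiderConjecture Dh ∧
      (padicValNat cell5.p
        (Nat.card (AddCommGroup.primaryComponent (c446d1.e.baseChange ℚ).sha cell5.p)) : ℤ) ≤ 1 - b ∧
      (1 - b ≤ 0 → Nat.card (AddCommGroup.primaryComponent (c446d1.e.baseChange ℚ).sha cell5.p) = 1) := by
  obtain ⟨hr, hfin, hSch, hle, hone⟩ := AtlasCurve.shaRowKatoK check.1 cell_mem s446d1_check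
    tam446d1_check.1 tam446d1_check.2.1 hS hf hK two_le_rank D hD htab Dh hDh hreg
  obtain ⟨h1, h2, h3⟩ := ints
  rw [h1, h2, h3] at hle hone
  refine ⟨hr, hfin, hSch, by omega, fun hb => hone (by omega)⟩

end Row446d1

end Summit.BirchSwinnertonDyer.BirchSwinnertonDyer.Rank2Sha

end
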